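import Summits.ResolutionOfSingularities.ResolutionOfSingularities.Theorems.EquisingularLiftEquisingularLiftNatSpecimenWhitneyCubicCiNose
import Summits.ResolutionOfSingularities.ResolutionOfSingularities.Theorems.EquisingularLiftEquisingularLiftNatSpecimenHypersurfaceChartRings
import Summits.ResolutionOfSingularities.ResolutionOfSingularities.Theorems.EquisingularLiftEquisingularLiftNatSpecimenCuspConeAlgebra
import HarnessLib

/-!
# [OURS · L1 W4.5(b) · EL♮(3)] NOSE ENGINE CERTIFICATION ‖ K — GENERIC DOUBLE-LINE BLOW-UP CHARTS: every blow-up of a hypersurface `V₊(F) ⊂ ℙ³_k` along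
# `𝓘⟨V(x₂,x₃)⟩ · 𝒪_H` is regular as soon as the two off-line chart rings and the four polynomial strict-transform charts are regular (R2's chart plumbing,
# ONCE, for an arbitrary form `F`)

Cell `res-hironaka`, slot W4.5(b); crux **EL♮(3)** (stmt-ResolutionOfSingularities-20148); width seat res-L1-w45b-nose-w3, row «NOSE ENGINE CERT ‖ K» of
res-L1-w45b-plan-1's WIDTH TABLE D1′. `--supports stmt-ResolutionOfSingularities-20148 --as helper`; closes nothing. OURS; NOT a statement of any
manuscript; AI-written, weaker than expert review. One `def` (`DoubleLine.gen`, the generator pair `x₂/x_c, x₃/x_c` read in `ChartRing F c`, as in R2), no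
`sorry`, standard axioms. Pattern: res-D-pv-022's `…NatSpecimenWhitneyCubicCharts` (R2) with the Whitney form replaced by a VARIABLE form `F` and the inputs it
reads from `…WhitneyCubicForms/Algebra` turned into HYPOTHESES; the transport `(ChartRing F c)[I/b] ≅ (k[y]/(f_c))[Ī/ȳ_{i₀}]` goes through res-D-pv-013's
`HypersurfaceSpecimen.exists_chartQuotEquiv` and pv-022's `WhitneyCubic.isRegularRing_blowupAlgebra_of_ringEquiv`.

WHAT (namespace `…Sections.DoubleLine`; `F ∈ k[x₀,…,x₃]` homogeneous of degree `e > 0`; `Σ = V(x₂, x₃)`; `cenVars = {1,2}` the centre variables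
of the chart rings `k[y₀,y₁,y₂]` of `D₊(x₀)`, `D₊(x₁)`, from `…NatSpecimenCuspConeAlgebra`):
* `isRegularRing_blowupAlgebra_tautVec` — `(ChartRing F c)[(x₂/x_c, x₃/x_c)/(x_a/x_c)]` is regular if `(k[y]/(f))[Ī/ȳ_{i₀}]` is, for `f = F(x_c := 1)` with `(f)`
  radical and `a = c.succAbove i₀`;
* `comap_chart_eq_ofIdealTop` — on `Spec (ChartRing F c)` the kill-map centre `Λ·𝒪_H` is `(x₂/x_c, x₃/x_c)~`;
* ★ **`isRegular_of_isBlowup_comap_vanishingIdeal`** — if the chart rings `ChartRing F 2`, `ChartRing F 3` are regular and the four strict-transform charts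
  `(k[y]/(f_c))[Ī/ȳ_{i₀}]` (`c = 0, 1`, `i₀ = 1, 2`; `f_c = F(x_c := 1)` radical) are regular, then EVERY blow-up of `H = V₊(F)` along `𝓘⟨Σ⟩ · 𝒪_H` is a regular
  scheme — the `hreg` input of `DoubleLine.reachNoseTowerBTriplePrime_of_isRegular_blowups` / `DoubleLine.elNatAt_of_isRegular_blowups`
  (`…NatNoseTowerBTriplePrimeDoubleLine`), kill-map-free. With `CuspCone.isRegularRing_strictTransformChart` (p643466) the four chart hypotheses are ONE
  polynomial identity + ONE unit derivative each: the next double-line specimen is pure polynomial algebra.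

References: The Stacks Project 0804; Liu 2002 Thm 8.1.19; Görtz–Wedhorn Prop. 13.96; Hartshorne II Prop. 5.9 — through the cited tree files.
-/

set_option linter.dupNamespace false -- mandated namespace `Summit.<Summit>.<Problem>` of this single-conjunct summit

noncomputable section

open CategoryTheory CategoryTheory.Limits AlgebraicGeometry TopologicalSpace
open MvPolynomial HomogeneousLocalization
open Literature.AlgebraicGeometry.Resolution
open Literature.AlgebraicGeometry.Motives Literature.AlgebraicGeometry.Motives.SmoothHypersurface
open Literature.AlgebraicGeometry.Motives.ProjectiveSpace
open AlgebraicGeometry.Scheme.IdealSheafData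
open Summit.ResolutionOfSingularities.ResolutionOfSingularities.Cruxes.EquisingularLift.StrataSplit

namespace Summit.ResolutionOfSingularities.ResolutionOfSingularities.Cruxes.EquisingularLiftNat.Sections

namespace DoubleLine

variable (k : Type) [Field k]

attribute [local instance] MvPolynomial.gradedAlgebra ProjBaseChange.algebraBase

/-! ## Transport of the strict-transform chart rings to `ChartRing F c` -/

/-- `X '' {1, 2} = {y₁, y₂}`. [folklore] -/
theorem image_X_cenVars : (X '' CuspCone.cenVars : Set (MvPolynomial (Fin 3) k)) = {X 1, X 2} := by
  rw [show (CuspCone.cenVars : Set (Fin 3)) = {1, 2} from rfl, Set.image_pair]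

/-- **The blow-up chart rings over `ChartRing F c` are regular when the polynomial strict-transform charts are**: for `f = F(x_c := 1)` with `(f)` radical,
the centre `(x₂/x_c, x₃/x_c)` and `b = x_a/x_c` with `a = c.succAbove i₀`, `(ChartRing F c)[I/b]` is regular whenever `(k[y]/(f))[(ȳ₁, ȳ₂)/ȳ_{i₀}]` is
(`HypersurfaceSpecimen.exists_chartQuotEquiv` + `WhitneyCubic.isRegularRing_blowupAlgebra_of_ringEquiv`). [folklore] -/
theorem isRegularRing_blowupAlgebra_tautVec (F : MvPolynomial (Fin 4) k) {e : ℕ} (hF : F.IsHomogeneous e) (c : Fin 4) (f : MvPolynomial (Fin 3) k)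
    (hf : dehomogenize k c F = f) (hrad : (Ideal.span {f}).radical = Ideal.span {f})
    (hc2 : (2 : Fin 4) = c.succAbove 1) (hc3 : (3 : Fin 4) = c.succAbove 2) (i₀ : Fin 3) (a : Fin 4) (ha : a = c.succAbove i₀)
    (hreg : IsRegularRing (blowupAlgebra ((Ideal.span (X '' CuspCone.cenVars)).map (Ideal.Quotient.mk (Ideal.span {f})))
      (Ideal.Quotient.mk (Ideal.span {f}) (X i₀ : MvPolynomial (Fin 3) k)))) :
    IsRegularRing (blowupAlgebra (Ideal.span {tautVec F c hF 2, tautVec F c hF 3}) (tautVec F c hF a)) := by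
  obtain ⟨θ, hθ⟩ := HypersurfaceSpecimen.exists_chartQuotEquiv F hF c f hf hrad
  have h2 : θ (tautVec F c hF 2) = Ideal.Quotient.mk _ (X 1) := by rw [hc2]; exact hθ 1
  have h3 : θ (tautVec F c hF 3) = Ideal.Quotient.mk _ (X 2) := by rw [hc3]; exact hθ 2
  have hb : θ (tautVec F c hF a) = Ideal.Quotient.mk (Ideal.span {f}) (X i₀) := by rw [ha]; exact hθ i₀
  have hI : (Ideal.span {tautVec F c hF 2, tautVec F c hF 3}).map θ.toRingHom =
      (Ideal.span (X '' CuspCone.cenVars)).map (Ideal.Quotient.mk (Ideal.span {f})) := by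
    rw [Ideal.map_span, Set.image_pair, Ideal.map_span, image_X_cenVars, Set.image_pair]
    exact congrArg₂ (fun u v => Ideal.span {u, v}) h2 h3
  refine WhitneyCubic.isRegularRing_blowupAlgebra_of_ringEquiv θ (Ideal.span {tautVec F c hF 2, tautVec F c hF 3}) (tautVec F c hF a) ?_
  rw [hI, hb]
  exact hreg

/-! ## The centre on the chart `Spec (ChartRing F c) → ℙ³_k` (R2's plumbing for a variable form) -/

section Chart

variable (F : MvPolynomial (Fin 4) k) {e : ℕ} (hF : F.IsHomogeneous e) (he : 0 < e)
variable (fk : homogeneousSubmodule (Fin (1 + 2 + 1)) k →+*ᵍ homogeneousSubmodule (Fin (1 + 1)) k)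
  (hfk' : HomogeneousIdeal.irrelevant (homogeneousSubmodule (Fin (1 + 1)) k) ≤
    (HomogeneousIdeal.irrelevant (homogeneousSubmodule (Fin (1 + 2 + 1)) k)).map fk) (hfkC : ∀ a : k, fk (C a) = C a)
  (hfkX : ∀ i : Fin (1 + 2 + 1), fk (X i) = if h : (i : ℕ) < 1 + 1 then X ⟨i, h⟩ else 0)
  (c : Fin 4)

include he in
/-- `Spec (ChartRing F c) → H ↪ ℙ³_k` is `Spec (k[x]_{(x_c)} → ChartRing F c)` followed by `D₊(x_c) ↪ ℙ³_k`. [folklore] -/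
theorem chart_left_comp_ι :
    (chart F c hF he).left ≫ (hypersurfaceι F).left =
      Spec.map (CommRingCat.ofHom (toChartRing F c hF).toRingHom) ≫
        Proj.awayι (homogeneousSubmodule (Fin (2 + 1 + 1)) k) (X c) (X_mem c) one_pos := by
  have h := congrArg (fun f => f.left) (chart_hypersurfaceι F c hF he)
  simp only [Over.comp_left, specOverOfAlgHom_left, awayChartι_left] at h
  exact h

/-- **Pulling a section `b` of `D₊(x_c)` back to `Spec (ChartRing F c)`** gives `[b]` (through `Γ(Spec A, ⊤) ≅ A`). [folklore] -/
theorem appLE_chart_awayToSection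
    (hle : (⊤ : (Spec (CommRingCat.of (ChartRing F c hF))).Opens) ≤
      (Spec.map (CommRingCat.ofHom (toChartRing F c hF).toRingHom) ≫
        Proj.awayι (homogeneousSubmodule (Fin (2 + 1 + 1)) k) (X c) (X_mem c) one_pos) ⁻¹ᵁ
          Proj.basicOpen (homogeneousSubmodule (Fin (2 + 1 + 1)) k) (X c))
    (b : Away (homogeneousSubmodule (Fin (2 + 1 + 1)) k) (X c)) :
    ((Spec.map (CommRingCat.ofHom (toChartRing F c hF).toRingHom) ≫
        Proj.awayι (homogeneousSubmodule (Fin (2 + 1 + 1)) k) (X c) (X_mem c) one_pos).appLE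
        (Proj.basicOpen (homogeneousSubmodule (Fin (2 + 1 + 1)) k) (X c)) ⊤ hle).hom
        ((Proj.awayToSection (homogeneousSubmodule (Fin (2 + 1 + 1)) k) (X c)).hom b) =
      (Scheme.ΓSpecIso (CommRingCat.of (ChartRing F c hF))).inv.hom (toChartRing F c hF b) := by
  have happ : (Spec.map (CommRingCat.ofHom (toChartRing F c hF).toRingHom) ≫
        Proj.awayι (homogeneousSubmodule (Fin (2 + 1 + 1)) k) (X c) (X_mem c) one_pos).appLE
        (Proj.basicOpen (homogeneousSubmodule (Fin (2 + 1 + 1)) k) (X c)) ⊤ hle =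
      (Proj.awayι (homogeneousSubmodule (Fin (2 + 1 + 1)) k) (X c) (X_mem c) one_pos).appLE
          (Proj.basicOpen (homogeneousSubmodule (Fin (2 + 1 + 1)) k) (X c)) ⊤
          (ProjFrac.awayι_preimage_basicOpen_self (X_mem (R := k) c) one_pos).ge ≫
        (Spec.map (CommRingCat.ofHom (toChartRing F c hF).toRingHom)).appLE ⊤ ⊤ le_rfl :=
    (Scheme.Hom.appLE_comp_appLE _ _ _ _ _ _ _).symm
  have htop : (Spec.map (CommRingCat.ofHom (toChartRing F c hF).toRingHom)).appLE ⊤ ⊤ le_rfl =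
      (Spec.map (CommRingCat.ofHom (toChartRing F c hF).toRingHom)).appTop :=
    (Scheme.Hom.app_eq_appLE _).symm
  rw [happ, ProjFrac.appLE_awayι_eq_resAway, htop, CategoryTheory.ConcreteCategory.comp_apply,
    ProjFrac.resAway_awayToSection]
  have hnat := Scheme.ΓSpecIso_inv_naturality (CommRingCat.ofHom (toChartRing F c hF).toRingHom)
  exact (congrArg (fun f => f.hom b) hnat).symm

/-- The generators `x_{c'}/x_c`, `c' ≥ 2`, of the centre, read in `ChartRing F c`. [folklore] -/
def gen : {c' : Fin (1 + 2 + 1) // 1 + 1 ≤ (c' : ℕ)} → ChartRing F c hF :=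
  fun c' => tautVec F c hF c'.1

/-- The generators are `x₂/x_c` and `x₃/x_c`. [folklore] -/
theorem range_gen : Set.range (gen k F hF c) = {tautVec F c hF 2, tautVec F c hF 3} := by
  ext t
  constructor
  · rintro ⟨⟨c', hc'⟩, rfl⟩
    have h : c' = 2 ∨ c' = 3 := by
      fin_cases c' <;> simp at hc' ⊢
    rcases h with rfl | rfl
    · exact Or.inl rfl
    · exact Or.inr rfl
  · rintro (rfl | rfl)
    · exact ⟨⟨2, by decide⟩, rfl⟩
    · exact ⟨⟨3, by decide⟩, rfl⟩

include he hfkC hfkX in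
/-- **THE CENTRE ON THE CHART**: the pull-back of `Λ = ker Proj(f_k)` along `Spec (ChartRing F c) → H ↪ ℙ³_k` is the ideal sheaf of
`(x₂/x_c, x₃/x_c) ⊆ ChartRing F c`. [folklore] -/
theorem comap_chart_eq_ofIdealTop :
    (((Proj.map fk hfk').ker.comap (hypersurfaceι F).left).comap (chart F c hF he).left :
        (Spec (CommRingCat.of (ChartRing F c hF))).IdealSheafData) =
      ofIdealTop ((Ideal.span (Set.range (gen k F hF c))).map (Scheme.ΓSpecIso (CommRingCat.of (ChartRing F c hF))).inv.hom) := by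
  haveI : IsAffine (Comma.left (specOver k (ChartRing F c hF))) :=
    inferInstanceAs (IsAffine (Spec (CommRingCat.of (ChartRing F c hF))))
  set π := Spec.map (CommRingCat.ofHom (toChartRing F c hF).toRingHom) ≫
    Proj.awayι (homogeneousSubmodule (Fin (2 + 1 + 1)) k) (X c) (X_mem c) one_pos with hπ
  have hcomp : ((Proj.map fk hfk').ker.comap (hypersurfaceι F).left).comap (chart F c hF he).left = (Proj.map fk hfk').ker.comap π := by
    rw [← Scheme.IdealSheafData.comap_comp]
    exact congrArg (fun f => (Proj.map fk hfk').ker.comap f) (chart_left_comp_ι k F hF he c)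
  refine hcomp.trans ?_
  let D : (Proj (homogeneousSubmodule (Fin (1 + 2 + 1)) k)).affineOpens :=
    ⟨Proj.basicOpen (homogeneousSubmodule (Fin (1 + 2 + 1)) k) (X c),
      Proj.isAffineOpen_basicOpen _ (X c) (LinearCentre.X_mem_one (r := 1) (m := 2) c) one_pos⟩
  have hV : ((⟨⊤, isAffineOpen_top _⟩ : (Spec (CommRingCat.of (ChartRing F c hF))).affineOpens) :
      (Spec (CommRingCat.of (ChartRing F c hF))).Opens) = π ⁻¹ᵁ (D : (Proj _).Opens) := by
    change ⊤ = Spec.map _ ⁻¹ᵁ (Proj.awayι (homogeneousSubmodule (Fin (2 + 1 + 1)) k) (X c) (X_mem c) one_pos ⁻¹ᵁ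
      Proj.basicOpen (homogeneousSubmodule (Fin (2 + 1 + 1)) k) (X c))
    rw [ProjFrac.awayι_preimage_basicOpen_self (X_mem (R := k) c) one_pos]
    rfl
  apply Scheme.IdealSheafData.ext_of_isAffine
  rw [ideal_ofIdealTop_top, Literature.AlgebraicGeometry.Limits.ideal_comap_eq_map π _ D _ hV,
    LinearCentre.ker_projMap_kill_ideal_basicOpen fk hfk' hfkC hfkX c, Ideal.map_span, Ideal.map_span,
    ← Set.range_comp, ← Set.range_comp]
  refine congrArg Ideal.span (congrArg Set.range (funext fun c' => ?_))
  simp only [Function.comp_apply]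
  rw [appLE_chart_awayToSection]
  rfl

end Chart

/-! ## Every blow-up of `H` along `𝓘⟨Σ⟩ · 𝒪_H` is regular -/

/-- **GENERIC DOUBLE-LINE BLOW-UP CHARTS.** For `F ∈ k[x₀,…,x₃]` homogeneous of positive degree whose chart rings OFF the line (`c = 2, 3`) are regular and whose
four polynomial strict-transform charts `(k[y]/(f_c))[Ī/ȳ_{i₀}]` (`c = 0, 1`, `i₀ = 1, 2`, `f_c = F(x_c := 1)` with `(f_c)` radical) are regular, EVERY
blow-up `ρ : Z → H` of `H = V₊(F)` along `𝓘⟨Σ⟩ · 𝒪_H` (`Σ = V(x₂, x₃)`) is a regular scheme. R2's proof: `𝓘⟨Σ⟩ = ker Proj(f_k)` (pv-013); over `D₊(x_c)` the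
blow-up is a blow-up of `Spec (ChartRing F c)` along `(x₂/x_c, x₃/x_c)~` (`comap_chart_eq_ofIdealTop`); for `c ≥ 2` that ideal is `(1)`; for `c ≤ 1` the
charts at the generators are spectra of the transported regular rings. [folklore; Stacks 0804, Liu 8.1.19, GW 13.96] -/
theorem isRegular_of_isBlowup_comap_vanishingIdeal (F : MvPolynomial (Fin 4) k) {e : ℕ} (hF : F.IsHomogeneous e) (he : 0 < e)
    (hreg23 : ∀ c : Fin 4, 2 ≤ (c : ℕ) → IsRegularRing (ChartRing F c hF))
    (f₀ f₁ : MvPolynomial (Fin 3) k) (hf₀ : dehomogenize k 0 F = f₀) (hf₁ : dehomogenize k 1 F = f₁)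
    (hrad₀ : (Ideal.span {f₀}).radical = Ideal.span {f₀}) (hrad₁ : (Ideal.span {f₁}).radical = Ideal.span {f₁})
    (h₀₁ : IsRegularRing (blowupAlgebra ((Ideal.span (X '' CuspCone.cenVars)).map (Ideal.Quotient.mk (Ideal.span {f₀})))
      (Ideal.Quotient.mk (Ideal.span {f₀}) (X 1 : MvPolynomial (Fin 3) k))))
    (h₀₂ : IsRegularRing (blowupAlgebra ((Ideal.span (X '' CuspCone.cenVars)).map (Ideal.Quotient.mk (Ideal.span {f₀})))
      (Ideal.Quotient.mk (Ideal.span {f₀}) (X 2 : MvPolynomial (Fin 3) k))))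
    (h₁₁ : IsRegularRing (blowupAlgebra ((Ideal.span (X '' CuspCone.cenVars)).map (Ideal.Quotient.mk (Ideal.span {f₁})))
      (Ideal.Quotient.mk (Ideal.span {f₁}) (X 1 : MvPolynomial (Fin 3) k))))
    (h₁₂ : IsRegularRing (blowupAlgebra ((Ideal.span (X '' CuspCone.cenVars)).map (Ideal.Quotient.mk (Ideal.span {f₁})))
      (Ideal.Quotient.mk (Ideal.span {f₁}) (X 2 : MvPolynomial (Fin 3) k)))) :
    ∀ (Z : Scheme.{0}) (ρ : Z ⟶ (hypersurface F).left),
      IsBlowup ρ ((vanishingIdeal (⟨_, WhitneyCubic.isClosed_doubleLine k⟩ :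
        Closeds (Literature.AlgebraicGeometry.Motives.projectiveSpace 3 k).left)).comap (hypersurfaceι F).left) →
      Scheme.IsRegular Z := by
  classical
  obtain ⟨fk, hfk', hfkC, hfkX⟩ := EquisingularLift.StrataSplit.LinearCentre.exists_kill k 1 2
  have hΛ := WhitneyCubic.ker_projMap_kill_eq_vanishingIdeal_doubleLine k fk hfk' hfkC hfkX (WhitneyCubic.isClosed_doubleLine k)
  -- the blow-up chart rings at the generators (`c = 0, 1`; `a = 2, 3`)
  have hgen : ∀ c : Fin 4, (c : ℕ) < 2 → ∀ a : Fin 4, 2 ≤ (a : ℕ) →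
      IsRegularRing (blowupAlgebra (Ideal.span {tautVec F c hF 2, tautVec F c hF 3}) (tautVec F c hF a)) := by
    intro c hc a ha
    have hc' : c = 0 ∨ c = 1 := by fin_cases c <;> simp at hc ⊢
    have ha' : a = 2 ∨ a = 3 := by fin_cases a <;> simp at ha ⊢
    rcases hc' with rfl | rfl
    · rcases ha' with rfl | rfl
      · exact isRegularRing_blowupAlgebra_tautVec k F hF 0 f₀ hf₀ hrad₀ (by decide) (by decide) 1 2 (by decide) h₀₁
      · exact isRegularRing_blowupAlgebra_tautVec k F hF 0 f₀ hf₀ hrad₀ (by decide) (by decide) 2 3 (by decide) h₀₂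
    · rcases ha' with rfl | rfl
      · exact isRegularRing_blowupAlgebra_tautVec k F hF 1 f₁ hf₁ hrad₁ (by decide) (by decide) 1 2 (by decide) h₁₁
      · exact isRegularRing_blowupAlgebra_tautVec k F hF 1 f₁ hf₁ hrad₁ (by decide) (by decide) 2 3 (by decide) h₁₂
  intro Z ρ hρ
  rw [← hΛ] at hρ
  intro z
  obtain ⟨c, hc⟩ := WhitneyCubic.exists_mem_basicOpen k ((hypersurfaceι F).left (ρ z))
  let U : (hypersurface F).left.Opens :=
    (hypersurfaceι F).left ⁻¹ᵁ Proj.basicOpen (homogeneousSubmodule (Fin (2 + 1 + 1)) k) (X c)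
  have hzU : ρ z ∈ U := hc
  have hrange : Set.range (chart F c hF he).left = Set.range U.ι := by
    rw [range_chart_left, Scheme.Opens.range_ι]
  let eU := IsOpenImmersion.isoOfRangeEq (chart F c hF he).left U.ι hrange
  have heU : eU.hom ≫ U.ι = (chart F c hF he).left := IsOpenImmersion.isoOfRangeEq_hom_fac _ _ _
  -- the restricted blow-up, moved to `Spec (ChartRing F c)`
  have hρU : IsBlowup ((ρ ∣_ U) ≫ eU.symm.hom) (ofIdealTop ((Ideal.span (Set.range (gen k F hF c))).map
      (Scheme.ΓSpecIso (CommRingCat.of (ChartRing F c hF))).inv.hom)) := by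
    have h := (hρ.restrict U).comp_iso eU.symm
    rw [← Scheme.IdealSheafData.comap_comp, Iso.symm_inv, heU] at h
    exact WhitneyCubic.isBlowup_of_ideal_eq h (comap_chart_eq_ofIdealTop k F hF he fk hfk' hfkC hfkX c)
  -- the stalk of `Z` at `z` is the stalk of the open piece `ρ⁻¹ U` at `⟨z, _⟩`
  haveI : IsIso ((ρ ⁻¹ᵁ U).ι.stalkMap ⟨z, hzU⟩) := inferInstance
  suffices hst : IsRegularLocalRing ((↑(ρ ⁻¹ᵁ U) : Scheme.{0}).presheaf.stalk ⟨z, hzU⟩) from by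
    haveI := hst
    exact IsRegularLocalRing.of_ringEquiv (asIso ((ρ ⁻¹ᵁ U).ι.stalkMap ⟨z, hzU⟩)).commRingCatIsoToRingEquiv.symm
  by_cases hc2 : 1 + 1 ≤ (c : ℕ)
  · -- `c = 2, 3`: the centre is the unit ideal, the blow-up is an isomorphism onto the regular `Spec (ChartRing F c)`
    have htop : Ideal.span (Set.range (gen k F hF c)) = ⊤ :=
      Ideal.eq_top_of_isUnit_mem _ (Ideal.subset_span ⟨⟨c, hc2⟩, rfl⟩)
        (by rw [show gen k F hF c ⟨c, hc2⟩ = tautVec F c hF c from rfl, tautVec_self]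
            exact isUnit_one)
    have hI : ofIdealTop ((Ideal.span (Set.range (gen k F hF c))).map
        (Scheme.ΓSpecIso (CommRingCat.of (ChartRing F c hF))).inv.hom) = ⊤ := by
      rw [htop, Ideal.map_top]
      exact Scheme.IdealSheafData.ext_of_isAffine (by rw [ideal_ofIdealTop_top]; rfl)
    have hρU' : IsBlowup ((ρ ∣_ U) ≫ eU.symm.hom) (⊤ : (Spec (CommRingCat.of (ChartRing F c hF))).IdealSheafData) := by
      rw [← hI]
      exact hρU
    haveI : IsIso ((ρ ∣_ U) ≫ eU.symm.hom) := hρU'.isIso isEffectiveCartier_top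
    haveI : IsRegularRing (ChartRing F c hF) := hreg23 c hc2
    haveI : IsRegularLocalRing ((Spec (CommRingCat.of (ChartRing F c hF))).presheaf.stalk (((ρ ∣_ U) ≫ eU.symm.hom) ⟨z, hzU⟩)) :=
      Scheme.isRegular_Spec (CommRingCat.of (ChartRing F c hF)) (((ρ ∣_ U) ≫ eU.symm.hom) ⟨z, hzU⟩)
    exact IsRegularLocalRing.of_ringEquiv
      (R := (Spec (CommRingCat.of (ChartRing F c hF))).presheaf.stalk (((ρ ∣_ U) ≫ eU.symm.hom) ⟨z, hzU⟩))
      (asIso (((ρ ∣_ U) ≫ eU.symm.hom).stalkMap ⟨z, hzU⟩)).commRingCatIsoToRingEquiv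
  · -- `c = 0, 1`: the charts at the generators are spectra of regular rings
    have hc' : (c : ℕ) < 2 := by omega
    obtain ⟨j, φ, hφ, hzφ, -⟩ := IsBlowup.exists_chart_of_span_range_eq hρU (gen k F hF c) rfl ⟨z, hzU⟩
    obtain ⟨w, hw⟩ := hzφ
    have hregj : IsRegularRing (blowupAlgebra (Ideal.span (Set.range (gen k F hF c))) (gen k F hF c j)) := by
      rw [range_gen]
      exact hgen c hc' j.1 j.2
    haveI := hregj
    by_contra hz
    rw [← hw] at hz
    exact not_isRegularLocalRing_localization_of_stalk φ w hz inferInstance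

end DoubleLine

end Summit.ResolutionOfSingularities.ResolutionOfSingularities.Cruxes.EquisingularLiftNat.Sections

end
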